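import Literature.NumberTheory.Automorphic.Liu2021.SplitPlaceHeckeEigenvaluesExplicit
import Literature.NumberTheory.GelbartRogawski1991.LocalSplittingQuadExtSplitMixedModel
import HarnessLib

/-!
# [Liu2021, Lemma D.1 (2)] at a split place for THE `θ`-package, `N = 2`: the local Hecke eigen-equations with `ν = θ_w`

Topic `Literature/NumberTheory/Automorphic/Liu2021`; proof file (one theorem: no definition, no named fact, no instance);
count-neutral.  Composition of

* `splitPlace_chiCoinv_heckeOperator_localInt_apply_explicit` (`SplitPlaceHeckeEigenvaluesExplicit`: for ANY smooth unitary section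
  `s` with a mixed model `(Γ, η)`, `η(κ_a) = νK(det a)`, `ν ∘ ι_w = νK`, `χ′(z_w) = χ(z)`: the `U(J)(𝒪_v)`-level operators of
  `e_w⁻¹(diag(ϖ,1))`, `e_w⁻¹(diag(ϖ,ϖ))` act on every fixed `χ`-coinvariant by `q_w^{1/2}(ν(ϖ) + χ′(ϖ)ν(ϖ)⁻¹)`, `χ′(ϖ)`), with
* `exists_mixedModel_undoubleLoc_localSplittingDatumQuadExt'` + `chi_det_symm_map` (`LocalSplittingQuadExtSplitMixedModel`: for
  the `θ`-PACKAGE section `s_v = undoubleLoc (localSplittingDatumQuadExt … θ).localSplitting` at a split `v` and ANY `w ∣ v` with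
  `c • w ≠ w`, the mixed model EXISTS with `η = θ_w ∘ det ∘ pr_w`, hence `νK = θ_w ∘ ι_w` and `ν = θ_w := θ.localComponent w`).

Result (`splitPlace_package_heckeOperator_localInt_apply`): for THE package section, every `U(J)(𝒪_v)`-fixed `χ`-coinvariant `y`
satisfies `[U(𝒪) e_w⁻¹(diag(ϖ,1)) U(𝒪)] y = q_w^{1/2}(θ_w(ϖ) + χ′(ϖ)θ_w(ϖ)⁻¹) • y` and `[U(𝒪) e_w⁻¹(diag(ϖ,ϖ)) U(𝒪)] y = χ′(ϖ) • y`
— the `hloc` input of `UnitaryGroup.IsHyperspecialAt.heckeTAt_apply_eq_smul` for the package's local factor, with NO mixed-model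
or character-pin hypothesis left (only the smoothness / `L²`-isometry of the package section, the centre data `(J₁, χ, χ′)` and good
reduction `hJi` remain as inputs).  For `θ = μᶜ` one has `θ_w = μ_w⁻¹`-type readings (`ConjugateSelfDualLocalValues`), which turn
the two numbers into the (R4) values `b_i = μ_i.valueAtUniformizer w` of the cell's S4 target.

## References

* Y. Liu, *Fourier–Jacobi cycles and arithmetic relative trace formula*, Cambridge J. Math. 9 (2021), App. D, Lemma D.1 (2) and
  its proof, p. 126. [Liu2021]
* S. Kudla, *Splitting metaplectic covers of dual reductive pairs*, Israel J. Math. 87 (1994), Thm. 3.1. [Kudla1994]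
* P. Cartier, Corvallis 1979, part 1, §IV (4.2). [CartierCorvallis1979]
-/

set_option autoImplicit false

noncomputable section

open NumberField IsDedekindDomain Matrix
open _root_.MeasureTheory
open scoped Matrix MatrixGroups
open ValuativeRel
open Literature.RepresentationTheory (TwistedCoinv.rep TwistedCoinv.Coinv TwistedCoinv.mk)
open Literature.RepresentationTheory.HeisenbergGroup (MpPsi leviOpPi)
open Literature.RepresentationTheory.HeisenbergGroup.SymplecticMatrix (glEquiv)
open Literature.NumberTheory.GelbartRogawski1991.UnitaryDualPair.LocalSplitting
  (iota LocalMp localSchrodinger undoubleLoc proj_undoubleLoc gramD)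
open Literature.NumberTheory.GelbartRogawski1991.UnitaryDualPair.LocalSplitting.QuadExt
  (localSplittingDatumQuadExt exists_mixedModel_undoubleLoc_localSplittingDatumQuadExt' chi_det_symm_map)
open Literature.NumberTheory.Automorphic.Zelevinsky1980 (lastBlockLabel maxParabolicLeviChar)
open Literature.NumberTheory.Automorphic.UnitaryGroup
open Literature.NumberTheory.GaloisRepresentations (HeckeCharacter)
open Literature.RepresentationTheory.HarrisKudlaSweet1996 (IsSplittingCharExt)

namespace Literature.NumberTheory.Automorphic.Liu2021

set_option maxHeartbeats 2000000 in -- as in `SplitPlaceOscillatorModelExplicit` / `SplitPlaceHeckeEigenvaluesExplicit`: instantiating the ≈ 40 heavy binders of the explicit model costs ≈ 1M heartbeats of `isDefEq`; the proof itself is 4 lines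
/-- **[Liu2021, Lem. D.1 (2)] at a split place for THE `θ`-package, `N = 2`: `T`-eigenvalues `q_w^{1/2}(θ_w(ϖ) + χ′(ϖ)θ_w(ϖ)⁻¹)` and
`χ′(ϖ)` on every `U(J)(𝒪_v)`-fixed `χ`-coinvariant.**  Data: a quadratic extension `E/F` of number fields with involution `c`, trace-zero
`δ`, a place `v` of `F`, the rank-`2` form `T₀ = diag(t)` with `J = T₀ ⊗ E`, `JD` the doubled form, a Hecke character `θ` of `E` with
`θ|_{𝕀_F} = ε_{E/F}` (`IsSplittingCharExt F E 1 θ`), a place `w ∣ v` with `c • w ≠ w` (so `v` splits), `J, JD` hermitian and of good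
reduction at `w` (`hJw`, `hJDw`, `hJi`), Haar measures; the PACKAGE section
`s_v := undoubleLoc (localSplittingDatumQuadExt … θ hθ).localSplitting` (assumed smooth and `L²`-isometric: `hsm`, `hsu`); centre data
`(J₁, χ, χ′)` with `χ′(z_w) = χ(z)`; a uniformizer `ϖ` of `E_w`.  Conclusion: the two `U(J)(𝒪_v)`-level double coset operators of
`e_w⁻¹(diag(ϖ,1))` and `e_w⁻¹(diag(ϖ,ϖ))` act on every fixed vector `y` of the `χ`-coinvariants of `ω_{s_v}` by
`q_w^{1/2}(θ_w(ϖ) + χ′(ϖ) θ_w(ϖ)⁻¹)` and `χ′(ϖ)`, `θ_w := θ.localComponent w`.  Proof: the package's mixed model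
(`exists_mixedModel_undoubleLoc_localSplittingDatumQuadExt'`, `η = θ_w ∘ det ∘ pr_w`), `hη := chi_det_symm_map`, `ν := θ_w`,
`hν := rfl`, into `splitPlace_chiCoinv_heckeOperator_localInt_apply_explicit`.
[cite: Liu2021, App. D, Lemma D.1 (2) and proof of Lemma D.1 (first paragraph), p. 126] [cite: Kudla1994, Thm. 3.1] -/
theorem splitPlace_package_heckeOperator_localInt_apply
    (F : Type) [Field F] [NumberField F] (E : Type) [Field E] [NumberField E] [Algebra F E]
    [Algebra.IsQuadraticExtension F E] (c : E ≃ₐ[F] E) (hc : c ≠ 1)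
    {δ : E} (hcδ : c δ = -δ) (hδ : δ ≠ 0) {d : F} (hd : δ * δ = algebraMap F E d)
    (v : HeightOneSpectrum (𝓞 F)) [MeasurableSpace (v.adicCompletion F)] [BorelSpace (v.adicCompletion F)]
    (μ : Measure (v.adicCompletion F)) [μ.IsAddHaarMeasure]
    {T₀ : Matrix (Fin 2) (Fin 2) F} (hT₀ : T₀.IsSymm) (hT₀d : IsUnit T₀.det)
    {J : Matrix (Fin 2) (Fin 2) E} (hJ : J = T₀.map (algebraMap F E))
    {JD : Matrix (Fin (2 + 2)) (Fin (2 + 2)) E} (hJD : JD = (gramD F 2 T₀).map (algebraMap F E))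
    (θ : HeckeCharacter E) (hθ : IsSplittingCharExt F E 1 θ) (t : Fin 2 → F) (hT₀t : T₀ = Matrix.diagonal t)
    (w : UnitaryGroup.PlacesOver E v) (hw : c • w.1 ≠ w.1) (hJc : (J.map c)ᵀ = J) (hJDc : (JD.map c)ᵀ = JD)
    (hJw : IsUnit (placeForm J w.1)) (hJDw : IsUnit (placeForm JD w.1))
    (μ' : Measure (v.adicCompletion F)) [μ'.IsAddHaarMeasure]
    (μX : Measure (Fin 2 → v.adicCompletion F)) [μX.IsAddHaarMeasure]
    -- the package section at `v`: smooth and `L²`-isometric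
    (hsm : Representation.IsSmooth ((MpPsi.toRep (localSchrodinger F 2 T₀ v)).comp
      (undoubleLoc F E c v 2 hJ hJD hcδ hδ hd hT₀ hT₀d
        (localSplittingDatumQuadExt F E c hcδ hδ hd v μ 2 hT₀ hT₀d hJD θ hθ).localSplitting
        (localSplittingDatumQuadExt F E c hcδ hδ hd v μ 2 hT₀ hT₀d hJD θ hθ).proj_localSplitting)))
    (hsu : Representation.IsL2Isometric μX ((MpPsi.toRep (localSchrodinger F 2 T₀ v)).comp
      (undoubleLoc F E c v 2 hJ hJD hcδ hδ hd hT₀ hT₀d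
        (localSplittingDatumQuadExt F E c hcδ hδ hd v μ 2 hT₀ hT₀d hJD θ hθ).localSplitting
        (localSplittingDatumQuadExt F E c hcδ hδ hd v μ 2 hT₀ hT₀d hJD θ hθ).proj_localSplitting)))
    -- the centre data
    (J₁ : Matrix (Fin 1) (Fin 1) E) (hJ₁ : J₁ 0 0 ≠ 0)
    [LocallyCompactSpace (standardParabolicGL ((w : HeightOneSpectrum (𝓞 E)).adicCompletion E)
      (Zelevinsky1980.lastBlockLabel 2))]
    (χ : UnitaryGroup.localPi E c 1 J₁ v →* ℂˣ) (hχu : ∀ z, ‖((χ z : ℂˣ) : ℂ)‖ = 1)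
    (hχc : Continuous fun z => ((χ z : ℂˣ) : ℂ))
    (χ' : ((w : HeightOneSpectrum (𝓞 E)).adicCompletion E)ˣ →* ℂˣ)
    (hχ' : ∀ z : UnitaryGroup.localPi E c 1 J₁ v,
      χ' (Matrix.GeneralLinearGroup.det ((z : UnitaryGroup.LocalGLPi E 1 v) w)) = χ z)
    -- good reduction of `J` at `w` and a uniformizer of `E_w`
    (hJi : hJw.unit ∈ glInt 2 ((w : HeightOneSpectrum (𝓞 E)).adicCompletion E))
    {ϖ : (w : HeightOneSpectrum (𝓞 E)).adicCompletion E} (hϖ : IsUniformizingElement ϖ)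
    {y : TwistedCoinv.Coinv
      (show Representation ℂ (UnitaryGroup.localPi E c 1 J₁ v) (SchwartzBruhat (Fin 2 → v.adicCompletion F)) from
        ((MpPsi.toRep (localSchrodinger F 2 T₀ v)).comp
          (undoubleLoc F E c v 2 hJ hJD hcδ hδ hd hT₀ hT₀d
            (localSplittingDatumQuadExt F E c hcδ hδ hd v μ 2 hT₀ hT₀d hJD θ hθ).localSplitting
            (localSplittingDatumQuadExt F E c hcδ hδ hd v μ 2 hT₀ hT₀d hJD θ hθ).proj_localSplitting)).comp
          (UnitaryGroup.localCenter E c 2 J J₁ hJ₁ v)) χ}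
    (hy : y ∈ (TwistedCoinv.rep
        (ρW := show Representation ℂ (UnitaryGroup.localPi E c 1 J₁ v) (SchwartzBruhat (Fin 2 → v.adicCompletion F)) from
          ((MpPsi.toRep (localSchrodinger F 2 T₀ v)).comp
            (undoubleLoc F E c v 2 hJ hJD hcδ hδ hd hT₀ hT₀d
              (localSplittingDatumQuadExt F E c hcδ hδ hd v μ 2 hT₀ hT₀d hJD θ hθ).localSplitting
              (localSplittingDatumQuadExt F E c hcδ hδ hd v μ 2 hT₀ hT₀d hJD θ hθ).proj_localSplitting)).comp
            (UnitaryGroup.localCenter E c 2 J J₁ hJ₁ v))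
        χ ((MpPsi.toRep (localSchrodinger F 2 T₀ v)).comp
            (undoubleLoc F E c v 2 hJ hJD hcδ hδ hd hT₀ hT₀d
              (localSplittingDatumQuadExt F E c hcδ hδ hd v μ 2 hT₀ hT₀d hJD θ hθ).localSplitting
              (localSplittingDatumQuadExt F E c hcδ hδ hd v μ 2 hT₀ hT₀d hJD θ hθ).proj_localSplitting))
        (fun g z => (show Commute g (UnitaryGroup.localCenter E c 2 J J₁ hJ₁ v z) from
          UnitaryGroup.localCenter_comm E c 2 J J₁ hJ₁ v z g).map
            ((MpPsi.toRep (localSchrodinger F 2 T₀ v)).comp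
              (undoubleLoc F E c v 2 hJ hJD hcδ hδ hd hT₀ hT₀d
                (localSplittingDatumQuadExt F E c hcδ hδ hd v μ 2 hT₀ hT₀d hJD θ hθ).localSplitting
                (localSplittingDatumQuadExt F E c hcδ hδ hd v μ 2 hT₀ hT₀d hJD θ hθ).proj_localSplitting)))).fixedPoints
        (UnitaryGroup.localInt E c 2 J v)) :
    heckeOperator
        (TwistedCoinv.rep
          (ρW := show Representation ℂ (UnitaryGroup.localPi E c 1 J₁ v) (SchwartzBruhat (Fin 2 → v.adicCompletion F)) from
            ((MpPsi.toRep (localSchrodinger F 2 T₀ v)).comp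
              (undoubleLoc F E c v 2 hJ hJD hcδ hδ hd hT₀ hT₀d
                (localSplittingDatumQuadExt F E c hcδ hδ hd v μ 2 hT₀ hT₀d hJD θ hθ).localSplitting
                (localSplittingDatumQuadExt F E c hcδ hδ hd v μ 2 hT₀ hT₀d hJD θ hθ).proj_localSplitting)).comp
              (UnitaryGroup.localCenter E c 2 J J₁ hJ₁ v))
          χ ((MpPsi.toRep (localSchrodinger F 2 T₀ v)).comp
              (undoubleLoc F E c v 2 hJ hJD hcδ hδ hd hT₀ hT₀d
                (localSplittingDatumQuadExt F E c hcδ hδ hd v μ 2 hT₀ hT₀d hJD θ hθ).localSplitting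
                (localSplittingDatumQuadExt F E c hcδ hδ hd v μ 2 hT₀ hT₀d hJD θ hθ).proj_localSplitting))
          (fun g z => (show Commute g (UnitaryGroup.localCenter E c 2 J J₁ hJ₁ v z) from
            UnitaryGroup.localCenter_comm E c 2 J J₁ hJ₁ v z g).map
              ((MpPsi.toRep (localSchrodinger F 2 T₀ v)).comp
                (undoubleLoc F E c v 2 hJ hJD hcδ hδ hd hT₀ hT₀d
                  (localSplittingDatumQuadExt F E c hcδ hδ hd v μ 2 hT₀ hT₀d hJD θ hθ).localSplitting
                  (localSplittingDatumQuadExt F E c hcδ hδ hd v μ 2 hT₀ hT₀d hJD θ hθ).proj_localSplitting))))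
        (UnitaryGroup.localInt E c 2 J v)
        ((UnitaryGroup.localPiSplitEquiv c J hc hJc w hw hJw).symm (heckeDiag 2 (Units.mk0 ϖ hϖ.ne_zero) 1)) y =
        ((Real.sqrt (GaloisRepresentations.IsNonarchimedeanLocalField.residueFieldCard
            ((w : HeightOneSpectrum (𝓞 E)).adicCompletion E)) : ℂ) *
          ((((θ.localComponent w.1) (Units.mk0 ϖ hϖ.ne_zero) : ℂˣ) : ℂ) +
            ((χ' (Units.mk0 ϖ hϖ.ne_zero) : ℂˣ) : ℂ) * ((((θ.localComponent w.1) (Units.mk0 ϖ hϖ.ne_zero) : ℂˣ) : ℂ))⁻¹)) • y ∧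
      heckeOperator
        (TwistedCoinv.rep
          (ρW := show Representation ℂ (UnitaryGroup.localPi E c 1 J₁ v) (SchwartzBruhat (Fin 2 → v.adicCompletion F)) from
            ((MpPsi.toRep (localSchrodinger F 2 T₀ v)).comp
              (undoubleLoc F E c v 2 hJ hJD hcδ hδ hd hT₀ hT₀d
                (localSplittingDatumQuadExt F E c hcδ hδ hd v μ 2 hT₀ hT₀d hJD θ hθ).localSplitting
                (localSplittingDatumQuadExt F E c hcδ hδ hd v μ 2 hT₀ hT₀d hJD θ hθ).proj_localSplitting)).comp
              (UnitaryGroup.localCenter E c 2 J J₁ hJ₁ v))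
          χ ((MpPsi.toRep (localSchrodinger F 2 T₀ v)).comp
              (undoubleLoc F E c v 2 hJ hJD hcδ hδ hd hT₀ hT₀d
                (localSplittingDatumQuadExt F E c hcδ hδ hd v μ 2 hT₀ hT₀d hJD θ hθ).localSplitting
                (localSplittingDatumQuadExt F E c hcδ hδ hd v μ 2 hT₀ hT₀d hJD θ hθ).proj_localSplitting))
          (fun g z => (show Commute g (UnitaryGroup.localCenter E c 2 J J₁ hJ₁ v z) from
            UnitaryGroup.localCenter_comm E c 2 J J₁ hJ₁ v z g).map
              ((MpPsi.toRep (localSchrodinger F 2 T₀ v)).comp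
                (undoubleLoc F E c v 2 hJ hJD hcδ hδ hd hT₀ hT₀d
                  (localSplittingDatumQuadExt F E c hcδ hδ hd v μ 2 hT₀ hT₀d hJD θ hθ).localSplitting
                  (localSplittingDatumQuadExt F E c hcδ hδ hd v μ 2 hT₀ hT₀d hJD θ hθ).proj_localSplitting))))
        (UnitaryGroup.localInt E c 2 J v)
        ((UnitaryGroup.localPiSplitEquiv c J hc hJc w hw hJw).symm (heckeDiag 2 (Units.mk0 ϖ hϖ.ne_zero) 2)) y =
        ((χ' (Units.mk0 ϖ hϖ.ne_zero) : ℂˣ) : ℂ) • y := by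
  obtain ⟨Γ, hΓi, hmodel⟩ := exists_mixedModel_undoubleLoc_localSplittingDatumQuadExt' F E c hcδ hδ hd v μ 2 hT₀ hT₀d hJ hJD
    θ hθ (by norm_num) t hT₀t w hw hc hJc hJDc hJw hJDw μ'
  exact splitPlace_chiCoinv_heckeOperator_localInt_apply_explicit F E c hc δ hcδ hδ d hd T₀ hT₀ hT₀d J hJ hJc v w hw hJw μX
    _ (proj_undoubleLoc F E c v 2 hJ hJD hcδ hδ hd hT₀ hT₀d _ _) hsm hsu J₁ hJ₁ μ' Γ
    ((θ.localComponent w.1).comp (Matrix.GeneralLinearGroup.det.comp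
      (UnitaryGroup.localPiSplitEquiv c J hc hJc w hw hJw).toMulEquiv.toMonoidHom))
    hΓi hmodel
    ((θ.localComponent w.1).comp
      (Units.map (toPlace v w : v.adicCompletion F →+* (w : HeightOneSpectrum (𝓞 E)).adicCompletion E).toMonoidHom))
    (fun a => chi_det_symm_map F E c v 2 hc hJc w hw hJw (θ.localComponent w.1) a)
    (θ.localComponent w.1) (fun _ => rfl) χ hχu hχc χ' hχ' hJi hϖ hy

end Literature.NumberTheory.Automorphic.Liu2021

end
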